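import Literature.NumberTheory.Sieve.CircleMethod
import HarnessLib

/-!
# Heath-Brown's identity

Trunk `AntSieve`.  Heath-Brown's combinatorial identity for the von Mangoldt function
(D. R. Heath-Brown, Canad. J. Math. 34 (1982), Lemma 1; Bombieri–Friedlander–Iwaniec, Acta Math.
156 (1986), Lemma 5, (2.1); Iwaniec–Kowalski, Prop. 13.3; Polymath, Algebra & Number Theory 8
(2014), Lemma 3.3): for `K ≥ 1`, a real `z ≥ 0` and every `n ≤ z^K`,

`Λ(n) = ∑_{j=1}^{K} (−1)^{j−1} (K choose j) (μ_{≤z}^{⋆j} ⋆ 1^{⋆(j−1)} ⋆ log)(n)`,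

where `μ_{≤z}(m) = μ(m) 1_{m ≤ z}` is the truncated Möbius function (the tree's `Literature.moebiusTrunc ⌊z⌋₊`,
`Literature.NumberTheory.Sieve.CircleMethod`) and `⋆` is Dirichlet convolution (Mathlib's product
of `ArithmeticFunction`s; `1 = ζ`, `log = ArithmeticFunction.log`).  This is the decomposition of
`Λ` into Type I/II sums used by Heath-Brown, BFI (§15, with `K = 7`), Zhang and Polymath 8.

Everything here is PROVED (a finite identity): with `E = δ − μ_{≤z} ⋆ 1`, `E(m) = 0` for
`m ≤ z` (Möbius inversion), hence `E^{⋆K}(m) = 0` for `m ≤ z^K` and `(E^{⋆K} ⋆ Λ)(n) = 0` for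
`n ≤ z^K`; expanding `E^{⋆K} = ∑_j (K choose j) (−1)^j (μ_{≤z} ⋆ 1)^{⋆j}` by the binomial theorem
and using `Λ ⋆ 1 = log` gives the identity (this is the proof in Polymath 8a, Lemma 3.3).

## Main statements

* `Literature.NumberTheory.Sieve.heathBrown_identity`: the identity above (`1 ≤ K`, `0 ≤ z`, `n ≤ z ^ K`, truncation
  `moebiusTrunc ⌊z⌋₊`); `Literature.NumberTheory.Sieve.heathBrown_identity_nat`: the same with a natural truncation point `U`
  and `n ≤ U ^ K`.
* `Literature.NumberTheory.Sieve.HeathBrown.moebiusTrunc_mul_zeta_apply`: `(μ_{≤U} ⋆ 1)(m) = δ(m)` for `m ≤ U`.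

## References

* D. R. Heath-Brown, *Prime numbers in short intervals and a generalized Vaughan identity*,
  Canad. J. Math. 34 (1982), 1365–1377, Lemma 1.
* E. Bombieri, J. B. Friedlander, H. Iwaniec, *Primes in arithmetic progressions to large moduli*,
  Acta Math. 156 (1986), 203–251, Lemma 5.
* D. H. J. Polymath, *New equidistribution estimates of Zhang type*, Algebra & Number Theory 8
  (2014), 2067–2199, Lemma 3.3 (statement with `U = (2x)^{1/K}` on `[x, 2x]`, and this proof).
* H. Iwaniec, E. Kowalski, *Analytic Number Theory*, AMS Coll. Publ. 53 (2004), Prop. 13.3.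
-/

open Finset Nat
open scoped ArithmeticFunction.Moebius ArithmeticFunction.vonMangoldt ArithmeticFunction.zeta

namespace Literature.NumberTheory.Sieve

namespace HeathBrown

/-! ### Small pieces of `ArithmeticFunction` algebra -/

/-- Evaluation of a finite sum of arithmetic functions. [folklore] -/
theorem finset_sum_apply {ι : Type*} (s : Finset ι) (f : ι → ArithmeticFunction ℝ) (n : ℕ) :
    (∑ i ∈ s, f i) n = ∑ i ∈ s, f i n := by
  induction s using Finset.cons_induction with
  | empty => simp
  | cons a s ha ih => rw [Finset.sum_cons, Finset.sum_cons, ArithmeticFunction.add_apply, ih]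

/-- A natural-number scalar (as an arithmetic function, supported at `1`) acts by
multiplication of values. [folklore] -/
theorem natCast_mul_apply (c : ℕ) (g : ArithmeticFunction ℝ) (n : ℕ) :
    ((c : ArithmeticFunction ℝ) * g) n = (c : ℝ) * g n := by
  induction c with
  | zero => simp
  | succ c ih => rw [Nat.cast_succ, add_mul, one_mul, ArithmeticFunction.add_apply, ih]; push_cast; ring

/-- Powers of `−1` (as arithmetic functions) act by the sign. [folklore] -/
theorem neg_one_pow_mul_apply (m : ℕ) (g : ArithmeticFunction ℝ) (n : ℕ) :
    (((-1 : ArithmeticFunction ℝ) ^ m) * g) n = (-1 : ℝ) ^ m * g n := by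
  -- (the `-1` of `ArithmeticFunction ℝ` is matched only after fixing the type explicitly)
  rcases Nat.even_or_odd m with h | h
  · have e : (-1 : ArithmeticFunction ℝ) ^ m = 1 := Even.neg_one_pow (α := ArithmeticFunction ℝ) h
    rw [e, h.neg_one_pow, one_mul, one_mul]
  · have e : (-1 : ArithmeticFunction ℝ) ^ m = -1 := Odd.neg_one_pow (α := ArithmeticFunction ℝ) h
    have e' : (-1 : ArithmeticFunction ℝ) * g = -g := neg_one_mul g
    rw [e, h.neg_one_pow, e', neg_one_mul, ArithmeticFunction.neg_apply]

/-- **Support of a Dirichlet convolution.** If `f` vanishes on `[0, A]` and `g` on `[0, B]` then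
`f ⋆ g` vanishes on `[0, AB]`: in `f(a) g(b)` with `ab = m ≤ AB` one of `a ≤ A`, `b ≤ B` holds. [folklore] -/
theorem mul_apply_eq_zero_of_le {f g : ArithmeticFunction ℝ} {A B : ℕ}
    (hf : ∀ m ≤ A, f m = 0) (hg : ∀ m ≤ B, g m = 0) {m : ℕ} (hm : m ≤ A * B) : (f * g) m = 0 := by
  rw [ArithmeticFunction.mul_apply]
  refine Finset.sum_eq_zero fun p hp => ?_
  rw [Nat.mem_divisorsAntidiagonal] at hp
  rcases le_or_gt p.1 A with ha | ha
  · rw [hf _ ha, zero_mul]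
  rcases le_or_gt p.2 B with hb | hb
  · rw [hg _ hb, mul_zero]
  exfalso
  have : A * B < p.1 * p.2 := Nat.mul_lt_mul_of_lt_of_le ha hb.le (by omega)
  omega

/-- **Support of a Dirichlet convolution, real thresholds.** If `f` vanishes at all `m ≤ A` and `g`
at all `m ≤ B` (`A, B ≥ 0` real) then `f ⋆ g` vanishes at all `m ≤ AB`. [folklore] -/
theorem mul_apply_eq_zero_of_le_real {f g : ArithmeticFunction ℝ} {A B : ℝ} (hA : 0 ≤ A) (hB : 0 ≤ B)
    (hf : ∀ m : ℕ, (m : ℝ) ≤ A → f m = 0) (hg : ∀ m : ℕ, (m : ℝ) ≤ B → g m = 0) {m : ℕ}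
    (hm : (m : ℝ) ≤ A * B) : (f * g) m = 0 := by
  rw [ArithmeticFunction.mul_apply]
  refine Finset.sum_eq_zero fun p hp => ?_
  rw [Nat.mem_divisorsAntidiagonal] at hp
  rcases le_or_gt (p.1 : ℝ) A with ha | ha
  · rw [hf _ ha, zero_mul]
  rcases le_or_gt (p.2 : ℝ) B with hb | hb
  · rw [hg _ hb, mul_zero]
  exfalso
  have h1 : A * B < (p.1 : ℝ) * p.2 := mul_lt_mul'' ha hb hA hB
  rw [← Nat.cast_mul, hp.1] at h1
  linarith

/-- If `f` vanishes on `[0, A]` then `f ⋆ g` vanishes on `[0, A]` (every divisor `a` of `m ≤ A`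
has `a ≤ A`). [folklore] -/
theorem mul_apply_eq_zero_of_le_left {f : ArithmeticFunction ℝ} (g : ArithmeticFunction ℝ) {A : ℕ}
    (hf : ∀ m ≤ A, f m = 0) {m : ℕ} (hm : m ≤ A) : (f * g) m = 0 := by
  rw [ArithmeticFunction.mul_apply]
  refine Finset.sum_eq_zero fun p hp => ?_
  rw [Nat.mem_divisorsAntidiagonal] at hp
  have hp1 : p.1 ≤ m := Nat.le_of_dvd (Nat.pos_of_ne_zero hp.2) ⟨p.2, hp.1.symm⟩
  rw [hf _ (hp1.trans hm), zero_mul]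

/-! ### The truncated Möbius function inverts `1` up to the truncation point -/

/-- **Möbius inversion below the truncation.** For `m ≤ U`,
`(μ_{≤U} ⋆ 1)(m) = ∑_{d ∣ m} μ(d) = δ(m)` (all divisors of `m` are `≤ U`). [folklore] -/
theorem moebiusTrunc_mul_zeta_apply (U : ℕ) {m : ℕ} (hm : m ≤ U) :
    ((moebiusTrunc U : ArithmeticFunction ℝ) * (ζ : ArithmeticFunction ℝ)) m =
      (1 : ArithmeticFunction ℝ) m := by
  rw [← ArithmeticFunction.coe_moebius_mul_coe_zeta (R := ℝ), ArithmeticFunction.mul_apply,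
    ArithmeticFunction.mul_apply]
  refine Finset.sum_congr rfl fun p hp => ?_
  rw [Nat.mem_divisorsAntidiagonal] at hp
  have hp1 : p.1 ≤ m := Nat.le_of_dvd (Nat.pos_of_ne_zero hp.2) ⟨p.2, hp.1.symm⟩
  rw [ArithmeticFunction.intCoe_apply, ArithmeticFunction.intCoe_apply, moebiusTrunc_apply,
    if_pos (hp1.trans hm)]

/-- The defect `E = δ − μ_{≤U} ⋆ 1` vanishes on `[0, U]`. [folklore] -/
theorem defect_apply_eq_zero (U : ℕ) {m : ℕ} (hm : m ≤ U) :
    (1 - (moebiusTrunc U : ArithmeticFunction ℝ) * (ζ : ArithmeticFunction ℝ)) m = 0 := by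
  rw [sub_eq_add_neg, ArithmeticFunction.add_apply, ArithmeticFunction.neg_apply,
    moebiusTrunc_mul_zeta_apply U hm, add_neg_cancel]

/-- Hence `E^{⋆k}` vanishes on `[0, U^k]` for `k ≥ 1`. [folklore] -/
theorem defect_pow_apply_eq_zero (U : ℕ) {k : ℕ} (hk : 1 ≤ k) {m : ℕ} (hm : m ≤ U ^ k) :
    ((1 - (moebiusTrunc U : ArithmeticFunction ℝ) * (ζ : ArithmeticFunction ℝ)) ^ k) m = 0 := by
  induction k, hk using Nat.le_induction generalizing m with
  | base => rw [pow_one] at hm ⊢; exact defect_apply_eq_zero U hm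
  | succ k hk ih =>
    rw [pow_succ]
    exact mul_apply_eq_zero_of_le (fun m hm => ih hm) (fun m hm => defect_apply_eq_zero U hm)
      (by rwa [pow_succ] at hm)

/-- Real truncation point: `E = δ − μ_{≤⌊z⌋} ⋆ 1` vanishes at every `m ≤ z`. [folklore] -/
theorem defect_apply_eq_zero_real {z : ℝ} {m : ℕ} (hm : (m : ℝ) ≤ z) :
    (1 - (moebiusTrunc ⌊z⌋₊ : ArithmeticFunction ℝ) * (ζ : ArithmeticFunction ℝ)) m = 0 :=
  defect_apply_eq_zero ⌊z⌋₊ (Nat.le_floor hm)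

/-- Hence `E^{⋆k}` vanishes at every `m ≤ z^k` for `k ≥ 1` (`z ≥ 0` real; this is stronger than
`m ≤ ⌊z⌋^k`). [folklore] -/
theorem defect_pow_apply_eq_zero_real {z : ℝ} (hz : 0 ≤ z) {k : ℕ} (hk : 1 ≤ k) {m : ℕ}
    (hm : (m : ℝ) ≤ z ^ k) :
    ((1 - (moebiusTrunc ⌊z⌋₊ : ArithmeticFunction ℝ) * (ζ : ArithmeticFunction ℝ)) ^ k) m = 0 := by
  induction k, hk using Nat.le_induction generalizing m with
  | base => rw [pow_one] at hm ⊢; exact defect_apply_eq_zero_real hm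
  | succ k hk ih =>
    rw [pow_succ]
    exact mul_apply_eq_zero_of_le_real (pow_nonneg hz k) hz (fun m hm => ih hm)
      (fun m hm => defect_apply_eq_zero_real hm) (by rwa [pow_succ] at hm)

/-- The `j`-th Heath-Brown term: `(μ_{≤U} ⋆ 1)^{⋆j} ⋆ Λ = μ_{≤U}^{⋆j} ⋆ 1^{⋆(j−1)} ⋆ log` for
`j ≥ 1` (from `Λ ⋆ 1 = log`, Mathlib's `vonMangoldt_mul_zeta`). [folklore] -/
theorem term_eq (U : ℕ) {j : ℕ} (hj : 1 ≤ j) :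
    ((moebiusTrunc U : ArithmeticFunction ℝ) * (ζ : ArithmeticFunction ℝ)) ^ j * Λ =
      (moebiusTrunc U : ArithmeticFunction ℝ) ^ j * (ζ : ArithmeticFunction ℝ) ^ (j - 1) *
        ArithmeticFunction.log := by
  obtain ⟨i, rfl⟩ := Nat.exists_eq_add_of_le' hj
  rw [Nat.add_sub_cancel, mul_pow, pow_succ, ← ArithmeticFunction.vonMangoldt_mul_zeta]
  ring

end HeathBrown

open HeathBrown in
/-- **Heath-Brown's identity** (Heath-Brown, Canad. J. Math. 34 (1982), Lemma 1;
Bombieri–Friedlander–Iwaniec, Acta Math. 156 (1986), Lemma 5; Iwaniec–Kowalski Prop. 13.3;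
Polymath 8a, Algebra & Number Theory 8 (2014), Lemma 3.3).  Let `K ≥ 1` be an integer, `z ≥ 0`
real, and `μ_{≤z} = moebiusTrunc ⌊z⌋₊` the Möbius function truncated to `[1, z]`.  Then for every
natural number `n ≤ z^K`,
`Λ(n) = ∑_{j=1}^{K} (−1)^{j+1} (K choose j) (μ_{≤z}^{⋆j} ⋆ ζ^{⋆(j−1)} ⋆ log)(n)`,
i.e. `Λ(n) = ∑_{j=1}^K (−1)^{j−1} (K choose j) ∑_{m₁⋯m_j n₁⋯n_j = n, mᵢ ≤ z} μ(m₁)⋯μ(m_j) log n₁`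
(Polymath's form: `z = (2x)^{1/K}`, valid for all `n ≤ 2x`; BFI's Lemma 5: `z = x^{1/J}`).  Proof:
`E = δ − μ_{≤z} ⋆ ζ` vanishes on `[1, z]`, so `E^{⋆K} ⋆ Λ` vanishes on `[1, z^K]`; expand
binomially and use `Λ ⋆ ζ = log`. [cite: Heathbrown1982, Lemma 1] -/
theorem heathBrown_identity {K : ℕ} (hK : 1 ≤ K) {z : ℝ} (hz : 0 ≤ z) {n : ℕ}
    (hn : (n : ℝ) ≤ z ^ K) :
    (Λ n : ℝ) = ∑ j ∈ Icc 1 K, (-1 : ℝ) ^ (j + 1) * (K.choose j : ℝ) *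
      ((moebiusTrunc ⌊z⌋₊ : ArithmeticFunction ℝ) ^ j * (ζ : ArithmeticFunction ℝ) ^ (j - 1) *
        ArithmeticFunction.log) n := by
  set M : ArithmeticFunction ℝ := (moebiusTrunc ⌊z⌋₊ : ArithmeticFunction ℝ) with hM
  set Z : ArithmeticFunction ℝ := (ζ : ArithmeticFunction ℝ) with hZ
  -- `E^K ⋆ Λ` vanishes at `n`: every divisor `d` of `n` has `d ≤ n ≤ z^K`
  have hvanish : ((1 - M * Z) ^ K * Λ) n = 0 := by
    rw [ArithmeticFunction.mul_apply]
    refine Finset.sum_eq_zero fun p hp => ?_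
    rw [Nat.mem_divisorsAntidiagonal] at hp
    have hp1 : p.1 ≤ n := Nat.le_of_dvd (Nat.pos_of_ne_zero hp.2) ⟨p.2, hp.1.symm⟩
    rw [defect_pow_apply_eq_zero_real hz hK ((Nat.cast_le.mpr hp1).trans hn), zero_mul]
  -- binomial expansion of `(1 - M Z)^K = ((-1) (M Z) + 1)^K`
  have hexp : (1 - M * Z) ^ K =
      ∑ j ∈ range (K + 1), (K.choose j : ArithmeticFunction ℝ) * ((-1) ^ j * (M * Z) ^ j) := by
    rw [show (1 - M * Z) = (-1) * (M * Z) + 1 by ring, add_pow]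
    refine Finset.sum_congr rfl fun j _ => ?_
    rw [one_pow, mul_one, mul_pow]
    ring
  rw [hexp, Finset.sum_mul, finset_sum_apply, Finset.sum_range_succ', Nat.choose_zero_right,
    Nat.cast_one, one_mul, pow_zero, pow_zero, one_mul, one_mul] at hvanish
  -- `hvanish : ∑_{j < K} (choose K (j+1) * ((-1)^(j+1) * (MZ)^(j+1)) * Λ) n + Λ n = 0`
  have hterm : ∀ j ∈ range K,
      ((K.choose (j + 1) : ArithmeticFunction ℝ) * ((-1) ^ (j + 1) * (M * Z) ^ (j + 1)) * Λ) n =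
        -((-1 : ℝ) ^ (j + 1 + 1) * (K.choose (j + 1) : ℝ) *
          (M ^ (j + 1) * Z ^ (j + 1 - 1) * ArithmeticFunction.log) n) := by
    intro j _
    rw [mul_assoc, natCast_mul_apply, mul_assoc, neg_one_pow_mul_apply,
      term_eq ⌊z⌋₊ (Nat.le_add_left 1 j), pow_succ (-1 : ℝ) (j + 1)]
    ring
  rw [Finset.sum_congr rfl hterm, Finset.sum_neg_distrib] at hvanish
  -- reindex `Icc 1 K` as `1 + j`, `j ∈ range K`
  rw [← Finset.Ico_add_one_right_eq_Icc, Finset.sum_Ico_eq_sum_range, Nat.add_sub_cancel]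
  simp_rw [add_comm 1]
  linarith

open HeathBrown in
/-- **Heath-Brown's identity, natural truncation point.** For natural numbers `K ≥ 1`, `U` and
`n ≤ U^K`: `Λ(n) = ∑_{j=1}^{K} (−1)^{j+1} (K choose j) (μ_{≤U}^{⋆j} ⋆ ζ^{⋆(j−1)} ⋆ log)(n)`
(the case `z = U` of `heathBrown_identity`). [cite: Heathbrown1982, Lemma 1] -/
theorem heathBrown_identity_nat {K : ℕ} (hK : 1 ≤ K) (U : ℕ) {n : ℕ} (hn : n ≤ U ^ K) :
    (Λ n : ℝ) = ∑ j ∈ Icc 1 K, (-1 : ℝ) ^ (j + 1) * (K.choose j : ℝ) *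
      ((moebiusTrunc U : ArithmeticFunction ℝ) ^ j * (ζ : ArithmeticFunction ℝ) ^ (j - 1) *
        ArithmeticFunction.log) n := by
  have h := heathBrown_identity hK (Nat.cast_nonneg U) (n := n) (by exact_mod_cast hn)
  rwa [Nat.floor_natCast] at h

open HeathBrown in
/-- The case `K = 1` of Heath-Brown's identity: for `n ≤ U`, `Λ(n) = (μ_{≤U} ⋆ log)(n)`, i.e. Möbius
inversion of `log = Λ ⋆ 1` seen through the truncation (Heath-Brown 1982, Lemma 1 with `k = 1`).
[cite: Heathbrown1982, Lemma 1] -/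
theorem vonMangoldt_apply_eq_moebiusTrunc_mul_log (U : ℕ) {n : ℕ} (hn : n ≤ U) :
    (Λ n : ℝ) = ((moebiusTrunc U : ArithmeticFunction ℝ) * ArithmeticFunction.log) n := by
  have h := heathBrown_identity_nat (K := 1) (n := n) le_rfl U (by rwa [pow_one])
  rw [Finset.Icc_self, Finset.sum_singleton] at h
  rw [h]
  norm_num

end Literature.NumberTheory.Sieve
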